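import Literature.AnabelianGeometry.EtaleTheta.ThetaRigidityLevelsSchemaClosures
import HarnessLib

/-!
# [EtTh] Cor. 2.18 (i) (theta-related subquotients) HOLDS at the level-`3` toy `RigidData.ToyN3.toy`:
# FACT row F-0620 `RigidData.Cor218_i` instance-PROVED (proof-only)

S. Mochizuki, *The Étale Theta Function …* [EtTh], Publ. RIMS **45** (2009), §2, Cor. 2.18 (i) "Theta-related
Subquotients", PRIMS text p. 60 (locators `p.N` = PDF pages; bib key `MochizukiEtTh2009`): the subquotients
`Π^tp_Y`, `Π^tp_Ÿ`, `Δ_X`, `(l·Δ_Θ)`, `Ker(Π^tp_X ↠ (Π^tp_X)^Θ)` of `Π^tp_X` and the labelled cusps "are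
reconstructed by a functorial group-theoretic algorithm" — typed by abc-iut-L2-t2 (`ThetaRigidity.lean`) as
invariance under EVERY automorphism of the topological group `Π^tp_X`.

PROOF-ONLY (no `def`, no instance, no new named fact; cell `abc-iut`, seat abc-iut-w6-d089, row F-0620).
abc-iut-w5-d175 showed the universal closure `∀ N l (R : RigidData N l), R.Cor218_i` is kernel-false
(`RigidData.Toy.not_forall_cor218_i`: at the level-`1` toy `Π^tp_X = ℤ × ℤ/2 × ℤ/2` the swap of the two
`ℤ/2`-factors moves `Π^tp_Ÿ`); the FACT-LIST renderer records the instance form of F-0620 as «open».  Here: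

* `ToyN3.mem_PiY_iff_pow_six`, `ToyN3.mem_PiYdd_iff_pow_three` — at abc-iut-w5-d175's level-`3` toy
  (`Π^tp_X := ℤ × (ℤ/2 × ℤ/3)`, `ThetaRigidityToyLevelThree.lean`) the two subgroups `Π^tp_Y = 0 × ℤ/2 × ℤ/3`
  and `Π^tp_Ÿ = (l·Δ_Θ) = 0 × 0 × ℤ/3` are the `6`-torsion and the `3`-torsion of `Π^tp_X`, hence
  CHARACTERISTIC (`ToyN3.map_eq_of_forall_mem_iff_pow`);
* **`ToyN3.cor218_i : ToyN3.toy.Cor218_i`** — all six clauses hold: the two torsion subgroups, `Δ_X = Π^tp_X`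
  (`G_K = 1`), `Ker ↠ Θ = 1`, `(l·Δ_Θ) = Π^tp_Ÿ`, and the (empty) cusp families are invariant under every
  `γ ∈ Aut(Π^tp_X)`;
* `cor218_i_schema_verdict` — «universal closure REFUTED (w5-d175) ∧ instance form PROVED», the shape of the
  other rows of the cluster; `ToyN3.cor218_i_and_iv_surjective` — at this toy Cor. 2.18 (i) holds TOGETHER with
  Cor. 2.18 (iv)-surjectivity (abc-iut-f-151's `ToyN3.cor218_iv_surjective`), while Cor. 2.18 (iv)-fibres fails
  there (`ToyN3.not_forall_cor218_iv_fibre`).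

HONEST FRAMING: a statement about the cell's own typing at one explicit (abelian, `D_Y = 1`) toy — a
satisfiability witness for the typed row, nothing more; print's Cor. 2.18 (i) concerns the tempered fundamental
group of a specific curve and is neither proved nor refuted here; nothing bears on [IUTchIII] Cor. 3.12; no side
taken; typed ≠ proved.
-/

namespace Literature.AnabelianGeometry.EtaleTheta

namespace RigidData

namespace ToyN3

open RigidData.Toy (M2)

/-! ## §1. `Π^tp_Y` and `Π^tp_Ÿ` are the `6`- and `3`-torsion of `Π^tp_X = ℤ × ℤ/2 × ℤ/3` -/

/-- In `ℤ/2` (multiplicative) sixth powers are trivial. [cite: MochizukiEtTh2009, Def 2.13 p.47] -/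
theorem M2.pow_six (a : M2) : a ^ 6 = 1 := by
  revert a
  decide

/-- In `ℤ/3` (multiplicative) sixth powers are trivial. [cite: MochizukiEtTh2009, Def 2.13 p.47] -/
theorem M3.pow_six (t : M3) : t ^ 6 = 1 := by
  revert t
  decide

/-- **`Π^tp_Y` is the `6`-torsion of `Π^tp_X`** at the level-`3` toy. [cite: MochizukiEtTh2009, Cor 2.18(i) p.60] -/
theorem mem_PiY_iff_pow_six (x : P3) : x ∈ PiY ↔ x ^ 6 = 1 := by
  obtain ⟨z, a, t⟩ := x
  rw [mem_PiY_iff]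
  constructor
  · rintro rfl
    ext
    · rfl
    · exact M2.pow_six a
    · exact M3.pow_six t
  · intro h
    -- `ℤ` has no `6`-torsion (cf. `Literature.FieldTheory.Kummer.RadicalLattice.eq_one_of_pow_eq_one_multiplicative`,
    -- not imported here to keep this toy file light)
    have hz : z ^ 6 = 1 := congrArg Prod.fst h
    have h1 : (6 : ℕ) • Multiplicative.toAdd z = 0 := by rw [← toAdd_pow, hz, toAdd_one]
    exact toAdd_eq_zero.1 ((smul_eq_zero.1 h1).resolve_left (by decide))

/-- **`Π^tp_Ÿ = (l·Δ_Θ)` is the `3`-torsion of `Π^tp_X`** at the level-`3` toy (abc-iut-f-151's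
`mem_PiYdd_iff_mem_PiY_and_pow_three`, with the `Π^tp_Y`-clause absorbed: `x³ = 1 ⇒ x⁶ = 1`).
[cite: MochizukiEtTh2009, Cor 2.18(i) p.60] -/
theorem mem_PiYdd_iff_pow_three (x : P3) : x ∈ PiYdd ↔ x ^ 3 = 1 := by
  rw [mem_PiYdd_iff_mem_PiY_and_pow_three, mem_PiY_iff_pow_six]
  constructor
  · exact fun h => h.2
  · intro h
    refine ⟨?_, h⟩
    rw [show (6 : ℕ) = 3 * 2 from rfl, pow_mul, h, one_pow]

/-- A subgroup cut out by `xⁿ = 1` is mapped ONTO itself by every group automorphism.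
[cite: MochizukiEtTh2009, Cor 2.18(i) p.60] -/
theorem map_eq_of_forall_mem_iff_pow (H : Subgroup P3) (n : ℕ) (hH : ∀ x, x ∈ H ↔ x ^ n = 1)
    (e : P3 ≃* P3) : H.map e.toMonoidHom = H := by
  ext x
  constructor
  · rintro ⟨y, hy, rfl⟩
    rw [SetLike.mem_coe, hH] at hy
    rw [hH, ← map_pow, hy, map_one]
  · intro hx
    refine ⟨e.symm x, ?_, e.apply_symm_apply x⟩
    rw [hH] at hx
    rw [SetLike.mem_coe, hH, ← map_pow, hx, map_one]

/-! ## §2. Cor. 2.18 (i) at the level-`3` toy -/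

/-- **Cor. 2.18 (i) HOLDS at the level-`3` toy** (F-0620 instance form): every automorphism `γ` of the
topological group `Π^tp_X = ℤ × ℤ/2 × ℤ/3` preserves `Π^tp_Y` (the `6`-torsion), `Π^tp_Ÿ` (the `3`-torsion),
`Δ_X = Π^tp_X` (`G_K = 1`), `Ker(Π^tp_X ↠ (Π^tp_X)^Θ) = 1`, `(l·Δ_Θ) = Π^tp_Ÿ`, and the (empty) families of
labelled cusps. [cite: MochizukiEtTh2009, Cor 2.18(i) p.60] -/
theorem cor218_i : Literature.AnabelianGeometry.EtaleTheta.RigidData.Cor218_i toy := by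
  intro γ
  have hY : PiY.map γ.toMulEquiv.toMonoidHom = PiY :=
    map_eq_of_forall_mem_iff_pow PiY 6 mem_PiY_iff_pow_six γ.toMulEquiv
  have hYdd : PiYdd.map γ.toMulEquiv.toMonoidHom = PiYdd :=
    map_eq_of_forall_mem_iff_pow PiYdd 3 mem_PiYdd_iff_pow_three γ.toMulEquiv
  refine ⟨hY, hYdd, ?_, ?_, hYdd, fun a => ?_⟩
  · -- `Δ_X = Ker(Π ↠ G_K) = Π`
    change (MonoidHom.ker (1 : P3 →* PUnit)).map γ.toMulEquiv.toMonoidHom = MonoidHom.ker (1 : P3 →* PUnit)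
    rw [MonoidHom.ker_one]
    exact Subgroup.map_top_of_surjective _ fun x => ⟨γ.symm x, γ.apply_symm_apply x⟩
  · -- `Ker ↠ Θ = 1`
    change (⊥ : Subgroup P3).map γ.toMulEquiv.toMonoidHom = ⊥
    exact Subgroup.map_bot _
  · -- no cusps
    change (fun H : Subgroup P3 => H.map γ.toMulEquiv.toMonoidHom) '' ∅ = ∅
    exact Set.image_empty _

/-- **At the level-`3` toy, Cor. 2.18 (i) and Cor. 2.18 (iv)-surjectivity hold TOGETHER** (abc-iut-f-151's
`ToyN3.cor218_iv_surjective`), while Cor. 2.18 (iv)-fibres fails there (`ToyN3.not_forall_cor218_iv_fibre`,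
abc-iut-w5-d175). [cite: MochizukiEtTh2009, Cor 2.18(iv) p.61] -/
theorem cor218_i_and_iv_surjective :
    Literature.AnabelianGeometry.EtaleTheta.RigidData.Cor218_i toy ∧
      Literature.AnabelianGeometry.EtaleTheta.RigidData.Cor218_iv_surjective toy :=
  ⟨cor218_i, cor218_iv_surjective⟩

end ToyN3

/-! ## §3. The row F-0620: universal closure REFUTED, instance PROVED -/

/-- **F-0620, instance form PROVED**: `Cor218_i` holds at SOME `RigidData` (the level-`3` toy).
[cite: MochizukiEtTh2009, Cor 2.18(i) p.60] -/
theorem exists_cor218_i :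
    ∃ R : RigidData.{0} 3 1, Literature.AnabelianGeometry.EtaleTheta.RigidData.Cor218_i R :=
  ⟨ToyN3.toy, ToyN3.cor218_i⟩

/-- **F-0620 verdict**: universal closure REFUTED (abc-iut-w5-d175's `Toy.not_forall_cor218_i`, the swap at the
level-`1` toy) ∧ instance form PROVED (the level-`3` toy) — a genuine hypothesis on the data, dischargeable
instance by instance (at the [EtTh] §1 model: lane C2, `Discharge/Sec2Cor218iModel.lean`), never a closed fact.
[cite: MochizukiEtTh2009, Cor 2.18(i) p.60] -/
theorem cor218_i_schema_verdict :
    (¬ ∀ (N : ℕ+) (l : ℕ) (R : RigidData.{0} N l),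
        Literature.AnabelianGeometry.EtaleTheta.RigidData.Cor218_i R) ∧
      ∃ R : RigidData.{0} 3 1, Literature.AnabelianGeometry.EtaleTheta.RigidData.Cor218_i R :=
  ⟨Toy.not_forall_cor218_i, exists_cor218_i⟩

end RigidData

end Literature.AnabelianGeometry.EtaleTheta
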